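import Summits.ABC.IUTFork.Joshi.ATS4GenuineResidualLambdaSevenFibres
import Summits.ABC.IUTFork.Joshi.ATS4DescentSpineGenuineResidual
import Summits.ABC.IUTFork.Joshi.ATS4DescentSpineVolFreeResidualObstruction
import Literature.IUT.LogVolume.Corollary22LegendreDeepAdmissiblePairs
import HarnessLib

/-!
# [J-IV] (arXiv:2403.10430v2) §6.10–§7.1, E5 descent spine: the GENUINE-COMPONENT residual of `abc_of_genuineResidualSupport`
# is UNSATISFIABLE ALREADY AT `d = 1` — a kernel countermodel on the `ℚ`-points `λ_k = 1/2 + 2/7^k` (R-J row Y-21 PARENT, small print (r2))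

Proof-only companion (0 defs) of the abc-iut cell, sub-cell R-J «JOSHI Y-DISCHARGE CENSUS» (rung LADDER-ABC:A2.RESCUE.J; table of record
`HOME/plan/E/R-J/Y-CENSUS.tsv`, row Y-21 PARENT), seat abc-iut-E-t35 (gen 10), on E-plan's GO 02:11:35Z (α) («keep/kill» words 01:50:56Z):
the census word v1.36 (E-plan 01:24:51Z / 01:34:44Z) records that the HYPOTHESIS `H` of E-t33's `abc_of_genuineResidualSupport` (p464392 §4) is
FALSE IN KERNEL (this seat's gen-9 `not_genuineResidualSupport_antecedent`, p480406, witness `d = 2`, the S-unit points `P_{a,c}`, `p₀ = 5`), with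
the small print (r2) (E-cx g6 01:24:34Z): «¬H goes through `d = 2`; the family kills every FIXED `d ≥ 2`, but a `d = 1` (ℚ-points-only) NARROWING of
the parent binder is NOT covered in kernel (λ_N / λ_k are the on-paper `d = 1` witnesses)». THIS FILE covers it: with `H₁ :=` the binder `H` with
`d` FIXED TO `1` (its `d = 1` instance VERBATIM: `H → H₁` is `fun h => h 1 one_pos`), **`H₁` is false in kernel**, on the tree's `ℚ`-family
`λ_k = 1/2 + 2/7^k` ([IUTchIV] Cor. 2.2 (ii) proof (P5) p.46; abc-iut-S-d3 / w5-d044 `Corollary22Thm110LegendreWitness` / `…DeepAdmissiblePairs`) at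
`p₀ = 7`, for EVERY prime `ℓ ≥ 11`:

* `LambdaSevenResidual.localExcess_arith` — the real inequality at `p₀ = 7`, `d = 1` (`e*_mod ≤ 2¹²·3³·5`), `k ≥ 10⁷`, every `ℓ ≥ 11`: the `q₇`-share
  is again `1/3` (`log q^∀(λ_k) ≤ 6k·log 7 + 12·log 2`, `q₇ = 2k·log 7`), failure ratio `ℓ(ℓ+1)/36` (E-cx-2's window-free form); core
  `252(k+1) < ℓ(ℓ+1)(7k − 11059221) − 168(ℓ+1)`, `k_fail(11) ≈ 2.17·10⁶` (lane 2's table: 2 172 387 with its constants);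
* **`LambdaSevenResidual.genuineResidualSupport_unsat`** — at `P = ratPoint λ_k` (`k ≥ 10⁷`), `d = 1`, and EVERY prime `ℓ ≥ 11`, the `∃`-body of the
  binder (VERBATIM, `d := 1`) is FALSE: `7 ∈ V^dst_ℚ` is forced by the support clause, `q₇ = 2k·log 7`, `d₇ ≤ log 7` on the whole division tower
  (companion `ATS4GenuineResidualLambdaSevenFibres`: degree-one base, `7 ∤ 46080` ⇒ tame all the way, `ThetaTower.hKtame`), `log 𝔮_F ≤ log q^∀(λ_k)`;
  the supplier CANNOT inflate `F`, `K`, `L_mod`, `V`, `D_K`; E-t50's `not_exists_volumes_of_localExcess` (p470440) leaves NO `(vol, vol_∞)`;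
* **`not_genuineResidualSupport_antecedent_degOne`** — HENCE `H₁` (the `d = 1` narrowing, stated VERBATIM) IS FALSE: the binder's own conditions are
  MET at `(P, ℓ) = (λ_k, ℓ)` with `ℓ` supplied by E-t30's `exists_isLem587Prime_lem678Room_offExc` at `d = 1` on `K_V = CBData.std {2}`
  (`Cor22.hypotheses_std`) off its bounded-height exceptional set, which `λ_k` escapes for `k` large by [IUTchIV] Cor. 2.2 (i) (`Cor22.partI_holds`,
  `Cor22.two_mul_log_seven_le_logQForall_lam`) — this supplier assembly is ADAPTED from E-cx-3 g4's staged `ResidualSupportUnsatOfFamily.lean`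
  (lane 3, 7d6823cd01f3039d; credit). Since `H → H₁`, this re-proves p480406's `¬H` (reader's check at the end, with `abc_of_genuineResidualSupport`
  applied to `h` BY NAME), and closes (r2): **`d = 1` covered in kernel on the `ℚ`-family `λ_k` (`p₀ = 7`, every prime `ℓ ≥ 11`)**.

EDGE (E-plan 01:50:56Z): at `d = 1` with `p₀ = 7` the excluded prime is `ℓ = 7` itself (tameness of `K/F` above `p₀` needs `ℓ ≠ p₀`), so the
edge here is «every prime `ℓ ≥ 11`»; `ℓ = 5` reverses the core inequality anyway (ratio `30/36 < 1`), as at `p₀ = 5` (rider (r4)). The binder's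
`ℓ` at `λ_k` is `≥ √(log q^∀) ≥ √(2k·log 7) > 11`. SOURCE locators: [J-IV] Prop. 6.10.9 p.69 l.1–28, (6.11.1) p.69 l.73–p.70 l.3, p.70 l.4–29,
p.71 l.107–110, Lemma 5.8.7 p.56 l.33–44 (render `HOME/lit/renders/Joshi-arxiv-2403.10430/`); [IUTchIV] Thm. 1.10 Step (v) p.27–28, Cor. 2.2
(i)–(ii) pp.41–46 (kurims). FRAMING (binding): a located COUNTERMODEL to the E5 residual AS PRINTED with (6.11.1)'s `Σ|·|` convention, at OUR typed
carriers, now at `d = 1` — not to any author's theorem; NO side taken on [IUTchIII] Cor. 3.12 / [IUTchIV] Thm. 1.10, on Joshi's claims or on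
Mochizuki's report on them; NOT an abc claim (nothing here proves or refutes abc); typed ≠ proved ≠ endorsed. Theorems only; standard axioms; FACT
rows none. [claim: Joshi2024ATS4, status: disputed].
-/

noncomputable section

namespace Summit.ABC.IUTFork.Joshi.ATS4

open NumberField IsDedekindDomain Finset
open Literature.IUT.LogVolume Literature.IUT.LogVolume.Cor22
open Literature.NumberTheory.DiophantineGeometry Literature.NumberTheory.DiophantineGeometry.GenEll
open Literature.NumberTheory.EllipticCurves
open scoped Classical

namespace LambdaSevenResidual

/-! ## 1. The real arithmetic of the local excess at `p₀ = 7`, `d = 1` -/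

/-- **The local excess at `7` beats the global cap, for every `ℓ ≥ 11`** (pure real arithmetic): with `Q ≤ 6k·log 7 + 12·log 2` (total
`log 𝔮_F ≤ log q^∀(λ_k)`), `q ≥ 2k·log 7` (the `7`-component of `log q`), `d ≤ log 7` (the `7`-component of `log 𝔡_K`), `E ≤ 552960 = 2¹²3³5`
(`e*_mod` at `e_mod ≤ d_mod ≤ 1`) and `0 ≤ ι ≤ (log 7)/7` (the Mertens weight), and `k ≥ 10⁷`:
`(1/2ℓ)·Q < ((ℓ+1)/4)·(q/6 − (1+4/ℓ)·d − (4/ℓ)·log 7 − (20/3)·E·ι)` — with `12·log 2 ≤ 6·log 7` and after dividing by `log 7 > 0` this follows from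
`252(k+1) < ℓ(ℓ+1)(7k − 11059221) − 168(ℓ+1)`, increasing in `ℓ`, true at `ℓ = 11` once `k > 2 172 350`. (Failure ratio `→ ℓ(ℓ+1)/36` of the
`q₇`-share `1/3`.) [folklore] -/
theorem localExcess_arith {ℓ k Q q d E ι : ℝ} (hℓ : 11 ≤ ℓ) (hk : 10 ^ 7 ≤ k) (hQ : Q ≤ 6 * k * Real.log 7 + 12 * Real.log 2)
    (hq : 2 * k * Real.log 7 ≤ q) (hd : d ≤ Real.log 7) (hE : E ≤ 552960) (hι0 : 0 ≤ ι) (hι : ι ≤ Real.log 7 / 7) :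
    1 / (2 * ℓ) * Q < (ℓ + 1) / 4 * (1 / 6 * q - (1 + 4 / ℓ) * d - 4 / ℓ * Real.log 7 - 20 / 3 * E * ι) := by
  have hL : 0 < Real.log 7 := Real.log_pos (by norm_num)
  have hℓ0 : 0 < ℓ := by linarith
  -- `12·log 2 ≤ 6·log 7`
  have hlog2 : 2 * Real.log 2 ≤ Real.log 7 := by
    have h := Real.log_le_log (by norm_num : (0 : ℝ) < 2 ^ 2) (by norm_num : (2 : ℝ) ^ 2 ≤ 7)
    rw [Real.log_pow] at h
    push_cast at h
    linarith
  have hQ' : Q ≤ (6 * k + 6) * Real.log 7 := by nlinarith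
  -- the polynomial core: `252(k+1) < ℓ(ℓ+1)(7k − 11059221) − 168(ℓ+1)`
  have hA : 0 ≤ 7 * k - 11059221 := by linarith
  have h1 : 11 * (7 * k - 11059221) - 168 ≤ ℓ * (7 * k - 11059221) - 168 := by nlinarith
  have h1' : 0 ≤ 11 * (7 * k - 11059221) - 168 := by linarith
  have h2 : 12 * (11 * (7 * k - 11059221) - 168) ≤ (ℓ + 1) * (ℓ * (7 * k - 11059221) - 168) := by nlinarith
  have key : 252 * (k + 1) < ℓ * (ℓ + 1) * (7 * k - 11059221) - 168 * (ℓ + 1) := by nlinarith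
  -- divide by `84ℓ`
  have hred : 3 * (k + 1) / ℓ < (ℓ + 1) / 4 * (k / 3 - 1 - 8 / ℓ - 3686400 / 7) := by
    have e1 : 3 * (k + 1) / ℓ = 252 * (k + 1) / (84 * ℓ) := by field_simp; ring
    have e2 : (ℓ + 1) / 4 * (k / 3 - 1 - 8 / ℓ - 3686400 / 7) = (ℓ * (ℓ + 1) * (7 * k - 11059221) - 168 * (ℓ + 1)) / (84 * ℓ) := by
      field_simp; ring
    rw [e1, e2]
    exact div_lt_div_of_pos_right key (by positivity)
  -- multiply by `log 7` and compare with the two sides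
  have hlhs : 1 / (2 * ℓ) * Q ≤ Real.log 7 * (3 * (k + 1) / ℓ) := by
    have : 1 / (2 * ℓ) * Q ≤ 1 / (2 * ℓ) * ((6 * k + 6) * Real.log 7) := mul_le_mul_of_nonneg_left hQ' (by positivity)
    calc 1 / (2 * ℓ) * Q ≤ 1 / (2 * ℓ) * ((6 * k + 6) * Real.log 7) := this
      _ = Real.log 7 * (3 * (k + 1) / ℓ) := by field_simp; ring
  have hEι : E * ι ≤ 552960 * (Real.log 7 / 7) := mul_le_mul hE hι hι0 (by norm_num)
  have hcoef : 0 ≤ 1 + 4 / ℓ := by positivity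
  have hdd : (1 + 4 / ℓ) * d ≤ (1 + 4 / ℓ) * Real.log 7 := mul_le_mul_of_nonneg_left hd hcoef
  have hrhs : Real.log 7 * ((ℓ + 1) / 4 * (k / 3 - 1 - 8 / ℓ - 3686400 / 7)) ≤
      (ℓ + 1) / 4 * (1 / 6 * q - (1 + 4 / ℓ) * d - 4 / ℓ * Real.log 7 - 20 / 3 * E * ι) := by
    have hin : Real.log 7 * (k / 3 - 1 - 8 / ℓ - 3686400 / 7) ≤
        1 / 6 * q - (1 + 4 / ℓ) * d - 4 / ℓ * Real.log 7 - 20 / 3 * E * ι := by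
      have e3 : Real.log 7 * (k / 3 - 1 - 8 / ℓ - 3686400 / 7) =
          1 / 6 * (2 * k * Real.log 7) - (1 + 4 / ℓ) * Real.log 7 - 4 / ℓ * Real.log 7
            - 20 / 3 * (552960 * (Real.log 7 / 7)) := by
        field_simp; ring
      rw [e3]; linarith
    have hc4 : 0 ≤ (ℓ + 1) / 4 := by positivity
    calc Real.log 7 * ((ℓ + 1) / 4 * (k / 3 - 1 - 8 / ℓ - 3686400 / 7))
        = (ℓ + 1) / 4 * (Real.log 7 * (k / 3 - 1 - 8 / ℓ - 3686400 / 7)) := by ring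
      _ ≤ (ℓ + 1) / 4 * (1 / 6 * q - (1 + 4 / ℓ) * d - 4 / ℓ * Real.log 7 - 20 / 3 * E * ι) :=
          mul_le_mul_of_nonneg_left hin hc4
  exact lt_of_le_of_lt hlhs (lt_of_lt_of_le (mul_lt_mul_of_pos_left hred hL) hrhs)

/-! ## 2. THE COUNTERMODEL AT `d = 1`: the genuine-component residual is unsatisfiable at `λ_k`, every prime `ℓ ≥ 11` -/

/-- **The GENUINE-COMPONENT residual (R4′) ∧ (R5) of `abc_of_genuineResidualSupport` (p464392 §4) is UNSATISFIABLE at the `ℚ`-point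
`λ_k = 1/2 + 2/7^k` (`k ≥ 10⁷`), `d = 1`, for EVERY prime `ℓ ≥ 11` (window-free).** The body below is that theorem's `∃`-body VERBATIM at `d := 1`,
`P := ratPoint λ_k`. Whatever theta field `F`, division tower `K ⊆ F(E_F[ℓ])`, `L_mod` (`e_mod ≤ d_mod ≤ 1`), `V^dst_ℚ` (forced to contain `7`:
`exists_mem_V_residueChar_eq_seven`), bookkeeping `D_K`, and local hull log-volumes the supplier returns: at `p₀ = 7` the genuine components are
`q₇ = 2k·log 7` (`qSeven_eq`) and `d₇ ≤ log 7` (`dSeven_le`), `log 𝔮_F = log q^{∤{2,ℓ}}(λ_k) ≤ log q^∀(λ_k) ≤ 6k·log 7 + 12·log 2` (Prop. 4.4.4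
`logq_ofNFPointOver_eq_logQAvoid`, `Cor22.logQAvoid_anti`, `Cor22.logQForall_ratPoint_lamSeven_le`), so the local excess beats the global cap
(`localExcess_arith`) and E-t50's `not_exists_volumes_of_localExcess` (p470440: (6.11.1) sums `|vol_p|`, no other prime absorbs it) leaves NO
`(vol, vol_∞)`. A located COUNTERMODEL to the E5 residual AS PRINTED with (6.11.1)'s `Σ|·|` convention, at `d = 1` — not to any author's theorem;
NO side taken on [IUTchIII] Cor. 3.12 / [IUTchIV] Thm. 1.10; NOT an abc claim. [claim: Joshi2024ATS4, status: disputed] -/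
theorem genuineResidualSupport_unsat {k : ℕ} (hk : 10 ^ 7 ≤ k) {ℓ : ℕ} (hℓ : ℓ.Prime) (h11 : 11 ≤ ℓ) :
    ¬ ∃ (F : Type) (_ : Field F) (_ : NumberField F) (_ : Algebra (ratPoint ((2 : ℚ)⁻¹ + 2 / 7 ^ k)).F F)
          (K : Type) (_ : Field K) (_ : NumberField K) (_ : Algebra F K) (_ : Algebra (ratPoint ((2 : ℚ)⁻¹ + 2 / 7 ^ k)).F K)
          (_ : IsScalarTower (ratPoint ((2 : ℚ)⁻¹ + 2 / 7 ^ k)).F F K)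
          (_ : IsGalois F K) (ψ : K →ₐ[F] AlgebraicClosure F) (hU : (ratPoint ((2 : ℚ)⁻¹ + 2 / 7 ^ k)).InU)
          (_ : IsThetaField (ratPoint ((2 : ℚ)⁻¹ + 2 / 7 ^ k)) F)
          (_ : letI := thetaCurve_isElliptic hU F
            ((thetaCurve (ratPoint ((2 : ℚ)⁻¹ + 2 / 7 ^ k)) F).galoisRepTorsion (ℓ : ℤ)).ker ≤ ψ.fieldRange.fixingSubgroup)
          (_ : 0 < (TateDivisorDatum.ofNFPointOver (ratPoint ((2 : ℚ)⁻¹ + 2 / 7 ^ k)) {2, ℓ} F).logq)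
          (Lmod : Type) (_ : Field Lmod) (_ : NumberField Lmod) (_ : Cor22.dmod (ratPoint ((2 : ℚ)⁻¹ + 2 / 7 ^ k)) ≤ dMod Lmod)
          (_ : dMod Lmod ≤ 1)
          (V : Finset ℕ)
          (_ : ∀ q ∈ V, q.Prime ∧ (q ∣ 2 * 3 * 5 * ℓ ∨
            (∃ v ∈ badPlacesAvoid (ratPoint ((2 : ℚ)⁻¹ + 2 / 7 ^ k)) {2, ℓ}, residueChar (ratPoint ((2 : ℚ)⁻¹ + 2 / 7 ^ k)).F v = q) ∨
            ∃ u : HeightOneSpectrum (𝓞 K), residueChar K u = q ∧ 2 ≤ u.asIdeal.ramificationIdx ℤ))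
          (_ : ∀ u : HeightOneSpectrum (𝓞 K), 2 ≤ u.asIdeal.ramificationIdx ℤ → residueChar K u ∈ V)
          (_ : ∀ w ∈ (TateDivisorDatum.ofNFPointOver (ratPoint ((2 : ℚ)⁻¹ + 2 / 7 ^ k)) {2, ℓ} F).V, residueChar F w ∈ V)
          (DK : Finset (HeightOneSpectrum (𝓞 K))) (_ : ∀ u, differentDivisor K (Sum.inr u) ≠ 0 → u ∈ DK)
          (vol : ℕ → ℝ) (volArch : ℝ),
          (∀ p ∈ V, -(1 / (((ℓ : ℝ) - 1) / 2)) * |vol p| ≤ ((ℓ : ℝ) + 1) / 4 *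
            ((1 + 4 / (ℓ : ℝ)) *
                ((Module.finrank ℚ K : ℝ)⁻¹ *
                  ∑ u ∈ DK with residueChar K u = p, differentDivisor K (Sum.inr u) * logNorm K u)
              - 1 / 6 *
                ((Module.finrank ℚ F : ℝ)⁻¹ *
                  ∑ w ∈ (TateDivisorDatum.ofNFPointOver (ratPoint ((2 : ℚ)⁻¹ + 2 / 7 ^ k)) {2, ℓ} F).V with residueChar F w = p,
                    (TateDivisorDatum.ofNFPointOver (ratPoint ((2 : ℚ)⁻¹ + 2 / 7 ^ k)) {2, ℓ} F).tateDivisor (Sum.inr w) * logNorm F w)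
              + 4 / (ℓ : ℝ) * Real.log p
              + 20 / 3 * ((2 ^ 12 * 3 ^ 3 * 5 * eMod Lmod : ℕ) : ℝ) *
                (if p ≤ 2 ^ 12 * 3 ^ 3 * 5 * eMod Lmod * ℓ then Real.log p / p else 0))) ∧
          -(1 / (2 * (ℓ : ℝ)) * (TateDivisorDatum.ofNFPointOver (ratPoint ((2 : ℚ)⁻¹ + 2 / 7 ^ k)) {2, ℓ} F).logq) ≤
            -(1 / (((ℓ : ℝ) - 1) / 2)) * (∑ p ∈ V, |vol p| + |volArch|) := by
  rintro ⟨F, _, _, _, K, _, _, _, _, _, _, ψ, hU, hF, hK, -, Lmod, _, _, -, hdmod, V, -, -, hbad, DK, -, vol, volArch,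
    hStepV, hLower⟩
  have hk1 : 1 ≤ k := le_trans (by norm_num) hk
  have hℓ7 : ℓ ≠ 7 := by omega
  -- `7 ∈ V^dst_ℚ`
  obtain ⟨w₇, hw₇, hres₇⟩ := exists_mem_V_residueChar_eq_seven hk1 hℓ hℓ7 F
  have h7V : 7 ∈ V := hres₇ ▸ hbad w₇ hw₇
  -- the three genuine numbers at `p₀ = 7`
  have hq7 := qSeven_eq hk1 hℓ hℓ7 F
  have hd7 := dSeven_le ψ hU hF hℓ hℓ7 hK DK
  have hQ : (TateDivisorDatum.ofNFPointOver (ratPoint ((2 : ℚ)⁻¹ + 2 / 7 ^ k)) {2, ℓ} F).logq ≤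
      6 * k * Real.log 7 + 12 * Real.log 2 := by
    rw [TateDivisorDatum.logq_ofNFPointOver_eq_logQAvoid]
    exact (logQAvoid_anti _ (Finset.empty_subset _)).trans (logQForall_ratPoint_lamSeven_le hk1)
  -- the Mertens coefficient `e*_mod ≤ 2¹²3³5` and weight `ι₇ ≤ (log 7)/7`
  have hE : (((2 ^ 12 * 3 ^ 3 * 5 * eMod Lmod : ℕ) : ℝ)) ≤ 552960 := by
    have h := (eMod_le_dMod (Lmod := Lmod)).trans hdmod
    have : ((eMod Lmod : ℕ) : ℝ) ≤ 1 := by exact_mod_cast h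
    push_cast; nlinarith
  have hι : ∀ N : ℕ, (0 : ℝ) ≤ (if 7 ≤ N then Real.log 7 / 7 else 0) ∧ (if 7 ≤ N then Real.log 7 / 7 else 0) ≤ Real.log 7 / 7 := by
    intro N
    have : 0 ≤ Real.log 7 / 7 := div_nonneg (Real.log_nonneg (by norm_num)) (by norm_num)
    split_ifs <;> exact ⟨by positivity, by linarith⟩
  refine not_exists_volumes_of_localExcess ℓ (by omega) V
    (fun p => (Module.finrank ℚ K : ℝ)⁻¹ * ∑ u ∈ DK with residueChar K u = p, differentDivisor K (Sum.inr u) * logNorm K u)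
    (fun p => (Module.finrank ℚ F : ℝ)⁻¹ *
      ∑ w ∈ (TateDivisorDatum.ofNFPointOver (ratPoint ((2 : ℚ)⁻¹ + 2 / 7 ^ k)) {2, ℓ} F).V with residueChar F w = p,
        (TateDivisorDatum.ofNFPointOver (ratPoint ((2 : ℚ)⁻¹ + 2 / 7 ^ k)) {2, ℓ} F).tateDivisor (Sum.inr w) * logNorm F w)
    ((2 ^ 12 * 3 ^ 3 * 5 * eMod Lmod : ℕ) : ℝ) _ (2 ^ 12 * 3 ^ 3 * 5 * eMod Lmod * ℓ) h7V ?_ ⟨vol, volArch, hStepV, hLower⟩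
  have h7 : ((7 : ℕ) : ℝ) = 7 := by norm_num
  simp only [h7]
  exact localExcess_arith (by exact_mod_cast h11) (by exact_mod_cast hk) hQ hq7.ge hd7 hE (hι _).1 (hι _).2

end LambdaSevenResidual

/-! ## 3. HENCE the `d = 1` narrowing `H₁` of the antecedent of `abc_of_genuineResidualSupport` is FALSE -/

/-- **THE `d = 1` NARROWING `H₁` OF THE ANTECEDENT OF `abc_of_genuineResidualSupport` (p464392 §4) IS FALSE** — the statement below is that
hypothesis with `d` FIXED TO `1`, VERBATIM (`H → H₁` is `fun h => h 1 one_pos`; reader's check at the end of the file), negated. Witness: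
`P = λ_k = 1/2 + 2/7^k ∈ U(ℚ̄)_{≤1} ∩ K_V` (`K_V = CBData.std {2}`: `Cor22.ratPoint_lam_mem_std_two`, `ratPoint_mem_UPle_one`) with `k ≥ 10⁷` beyond
the bounded-height exceptional set of E-t30's supplier `exists_isLem587Prime_lem678Room_offExc` at `d = 1` (`Cor22.hypotheses_std`; escape by
[IUTchIV] Cor. 2.2 (i) `Cor22.partI_holds` and `log q^∀(λ_k) ≥ 2k·log 7`, `Cor22.two_mul_log_seven_le_logQForall_lam`), which then furnishes `ℓ` with
`IsLem587Prime 1 P ℓ ∧ ITDConditions P ℓ ∧ AdmitsCore P ∧ room` — all conditions of the binder MET — and `ℓ ≥ √(log q^∀) ≥ 11`; the `∃`-conclusion is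
refuted by `LambdaSevenResidual.genuineResidualSupport_unsat`. (Supplier assembly adapted from E-cx-3 g4's staged lane-3 scratch
`ResidualSupportUnsatOfFamily.lean`, 7d6823cd01f3039d.) So the census word's small print (r2) becomes «`d = 1` covered in kernel on the `ℚ`-family
`λ_k` (`p₀ = 7`, every prime `ℓ ≥ 11`)»: `abc_of_genuineResidualSupport` stays VACUOUS even if its binder is narrowed to `ℚ`-points. LOCATES; no side
taken on [IUTchIII] Cor. 3.12 / [IUTchIV] Thm. 1.10 or on any author; NOT an abc claim; typed ≠ proved ≠ endorsed. [claim: Joshi2024ATS4, status: disputed] -/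
theorem not_genuineResidualSupport_antecedent_degOne :
    ¬ (∀ P ∈ UPle 1, ∀ (ℓ : ℕ) (hℓ : ℓ.Prime) (h5 : 5 ≤ ℓ), IsLem587Prime 1 P ℓ → ITDConditions P ℓ →
      AdmitsCore P → Real.log (4 * (2 ^ 12 * 3 ^ 3 * 5 * ((1 : ℕ) : ℝ)) * ℓ) ≤ 4 / 3 * ℓ →
        ∃ (F : Type) (_ : Field F) (_ : NumberField F) (_ : Algebra P.F F)
          (K : Type) (_ : Field K) (_ : NumberField K) (_ : Algebra F K) (_ : Algebra P.F K) (_ : IsScalarTower P.F F K)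
          (_ : IsGalois F K) (ψ : K →ₐ[F] AlgebraicClosure F) (hU : P.InU) (_ : IsThetaField P F)
          (_ : letI := thetaCurve_isElliptic hU F
            ((thetaCurve P F).galoisRepTorsion (ℓ : ℤ)).ker ≤ ψ.fieldRange.fixingSubgroup)
          (_ : 0 < (TateDivisorDatum.ofNFPointOver P {2, ℓ} F).logq)
          (Lmod : Type) (_ : Field Lmod) (_ : NumberField Lmod) (_ : Cor22.dmod P ≤ dMod Lmod) (_ : dMod Lmod ≤ 1)
          (V : Finset ℕ)
          (_ : ∀ q ∈ V, q.Prime ∧ (q ∣ 2 * 3 * 5 * ℓ ∨ (∃ v ∈ badPlacesAvoid P {2, ℓ}, residueChar P.F v = q) ∨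
            ∃ u : HeightOneSpectrum (𝓞 K), residueChar K u = q ∧ 2 ≤ u.asIdeal.ramificationIdx ℤ))
          (_ : ∀ u : HeightOneSpectrum (𝓞 K), 2 ≤ u.asIdeal.ramificationIdx ℤ → residueChar K u ∈ V)
          (_ : ∀ w ∈ (TateDivisorDatum.ofNFPointOver P {2, ℓ} F).V, residueChar F w ∈ V)
          (DK : Finset (HeightOneSpectrum (𝓞 K))) (_ : ∀ u, differentDivisor K (Sum.inr u) ≠ 0 → u ∈ DK)
          (vol : ℕ → ℝ) (volArch : ℝ),
          (∀ p ∈ V, -(1 / (((ℓ : ℝ) - 1) / 2)) * |vol p| ≤ ((ℓ : ℝ) + 1) / 4 *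
            ((1 + 4 / (ℓ : ℝ)) *
                ((Module.finrank ℚ K : ℝ)⁻¹ *
                  ∑ u ∈ DK with residueChar K u = p, differentDivisor K (Sum.inr u) * logNorm K u)
              - 1 / 6 *
                ((Module.finrank ℚ F : ℝ)⁻¹ *
                  ∑ w ∈ (TateDivisorDatum.ofNFPointOver P {2, ℓ} F).V with residueChar F w = p,
                    (TateDivisorDatum.ofNFPointOver P {2, ℓ} F).tateDivisor (Sum.inr w) * logNorm F w)
              + 4 / (ℓ : ℝ) * Real.log p
              + 20 / 3 * ((2 ^ 12 * 3 ^ 3 * 5 * eMod Lmod : ℕ) : ℝ) *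
                (if p ≤ 2 ^ 12 * 3 ^ 3 * 5 * eMod Lmod * ℓ then Real.log p / p else 0))) ∧
          -(1 / (2 * (ℓ : ℝ)) * (TateDivisorDatum.ofNFPointOver P {2, ℓ} F).logq) ≤
            -(1 / (((ℓ : ℝ) - 1) / 2)) * (∑ p ∈ V, |vol p| + |volArch|)) := by
  intro h
  -- adapted from lane 3's staged `ResidualSupportUnsatOfFamily.lean` (E-cx-3 g4, 7d6823cd01f3039d): E-t30's supplier at `d = 1` on `K_V = CBData.std {2}`
  have hS : ∀ p ∈ ({2} : Finset ℕ), p.Prime := by simp [Nat.prime_two]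
  have hD : Hypotheses (CBData.std {2} hS) := hypotheses_std {2} hS (by simp)
  obtain ⟨Exc, ⟨H, hH⟩, hsup⟩ := exists_isLem587Prime_lem678Room_offExc (CBData.std {2} hS) hD (d := 1) one_pos
  -- [IUTchIV] Cor. 2.2 (i): `(1/6)·log(q^∀) − ht ≤ C` on `K_V`
  obtain ⟨_, h23, h3⟩ := partI_holds (CBData.std {2} hS) hD
  obtain ⟨C, hC⟩ := (h23.trans h3).bdLe
  have hlog7 : (0 : ℝ) < Real.log 7 := Real.log_pos (by norm_num)
  -- choose `k ≥ 10⁷` with `k·log 7 > 3(H + C)`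
  obtain ⟨n, hn⟩ := exists_nat_gt (3 * (H + C) / Real.log 7)
  obtain ⟨k, hk7, hkn⟩ : ∃ k : ℕ, 10 ^ 7 ≤ k ∧ n ≤ k := ⟨max (10 ^ 7) n, le_max_left _ _, le_max_right _ _⟩
  have hk1 : 1 ≤ k := le_trans (by norm_num) hk7
  have hk2 : 2 ≤ k := le_trans (by norm_num) hk7
  have hknR : (n : ℝ) ≤ k := by exact_mod_cast hkn
  have hkHC : 3 * (H + C) < k * Real.log 7 := by
    have := (div_lt_iff₀ hlog7).mp (lt_of_lt_of_le hn hknR)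
    linarith
  -- the point `λ_k`
  have hPD : ratPoint ((2 : ℚ)⁻¹ + 2 / 7 ^ k) ∈ (CBData.std {2} hS).toSet := ratPoint_lam_mem_std_two hk2 hS
  have hP1 : ratPoint ((2 : ℚ)⁻¹ + 2 / 7 ^ k) ∈ UPle 1 := ratPoint_mem_UPle_one (lamSeven_ne hk1).1 (lamSeven_ne hk1).2
  have hQlow : 2 * (k : ℝ) * Real.log 7 ≤ logQForall (ratPoint ((2 : ℚ)⁻¹ + 2 / 7 ^ k)) :=
    two_mul_log_seven_le_logQForall_lam hk1
  have hPexc : ratPoint ((2 : ℚ)⁻¹ + 2 / 7 ^ k) ∉ Exc := by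
    intro hmem
    have h1 : (ratPoint ((2 : ℚ)⁻¹ + 2 / 7 ^ k)).ht ≤ H := hH _ hmem
    have h2 : 1 / 6 * logQForall (ratPoint ((2 : ℚ)⁻¹ + 2 / 7 ^ k)) - (ratPoint ((2 : ℚ)⁻¹ + 2 / 7 ^ k)).ht ≤ C := hC _ hPD
    nlinarith
  -- the supplied prime, and `ℓ ≥ 11` from `√(log q^∀) ≤ ℓ`
  obtain ⟨ℓ, hℓP, hITD, hcore, hroom⟩ := hsup _ ⟨hPD, hP1⟩ hPexc
  have hℓ : ℓ.Prime := hℓP.1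
  have h7 : 7 ≤ ℓ := hITD.1
  have h11 : 11 ≤ ℓ := by
    have hs : Real.sqrt (logQForall (ratPoint ((2 : ℚ)⁻¹ + 2 / 7 ^ k))) ≤ ℓ := hℓP.2.1
    have hlog27 : 2 * Real.log 2 ≤ Real.log 7 := by
      have h := Real.log_le_log (by norm_num : (0 : ℝ) < 2 ^ 2) (by norm_num : (2 : ℝ) ^ 2 ≤ 7)
      rw [Real.log_pow] at h
      push_cast at h
      linarith
    have hk7R : (10 : ℝ) ^ 7 ≤ k := by exact_mod_cast hk7
    have h121 : (121 : ℝ) ≤ logQForall (ratPoint ((2 : ℚ)⁻¹ + 2 / 7 ^ k)) := by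
      have := Real.log_two_gt_d9
      nlinarith
    have h11s : (11 : ℝ) ≤ Real.sqrt (logQForall (ratPoint ((2 : ℚ)⁻¹ + 2 / 7 ^ k))) :=
      Real.le_sqrt_of_sq_le (by nlinarith)
    exact_mod_cast h11s.trans hs
  exact LambdaSevenResidual.genuineResidualSupport_unsat hk7 hℓ h11
    (h _ hP1 ℓ hℓ (by omega) hℓP hITD hcore hroom)

/-! ## Reader's check: `H₁` IS the `d = 1` instance of the hypothesis `h` of `abc_of_genuineResidualSupport`; hence `¬H` again (cf. p480406) -/

/-- The hypothesis `h` below is typed BY NAME by p464392's `abc_of_genuineResidualSupport` (first line of the body), and its `d = 1` instance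
`h 1 one_pos` is LITERALLY the statement negated by `not_genuineResidualSupport_antecedent_degOne`; so `¬H` follows from `¬H₁` — a second,
`d = 1` proof of this seat's gen-9 `not_genuineResidualSupport_antecedent` (p480406). [claim: Joshi2024ATS4, status: disputed] -/
example : ¬ (∀ (d : ℕ), 0 < d → ∀ P ∈ UPle d, ∀ (ℓ : ℕ) (hℓ : ℓ.Prime) (h5 : 5 ≤ ℓ), IsLem587Prime d P ℓ → ITDConditions P ℓ →
      AdmitsCore P → Real.log (4 * (2 ^ 12 * 3 ^ 3 * 5 * (d : ℝ)) * ℓ) ≤ 4 / 3 * ℓ →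
        ∃ (F : Type) (_ : Field F) (_ : NumberField F) (_ : Algebra P.F F)
          (K : Type) (_ : Field K) (_ : NumberField K) (_ : Algebra F K) (_ : Algebra P.F K) (_ : IsScalarTower P.F F K)
          (_ : IsGalois F K) (ψ : K →ₐ[F] AlgebraicClosure F) (hU : P.InU) (_ : IsThetaField P F)
          (_ : letI := thetaCurve_isElliptic hU F
            ((thetaCurve P F).galoisRepTorsion (ℓ : ℤ)).ker ≤ ψ.fieldRange.fixingSubgroup)
          (_ : 0 < (TateDivisorDatum.ofNFPointOver P {2, ℓ} F).logq)
          (Lmod : Type) (_ : Field Lmod) (_ : NumberField Lmod) (_ : Cor22.dmod P ≤ dMod Lmod) (_ : dMod Lmod ≤ d)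
          (V : Finset ℕ)
          (_ : ∀ q ∈ V, q.Prime ∧ (q ∣ 2 * 3 * 5 * ℓ ∨ (∃ v ∈ badPlacesAvoid P {2, ℓ}, residueChar P.F v = q) ∨
            ∃ u : HeightOneSpectrum (𝓞 K), residueChar K u = q ∧ 2 ≤ u.asIdeal.ramificationIdx ℤ))
          (_ : ∀ u : HeightOneSpectrum (𝓞 K), 2 ≤ u.asIdeal.ramificationIdx ℤ → residueChar K u ∈ V)
          (_ : ∀ w ∈ (TateDivisorDatum.ofNFPointOver P {2, ℓ} F).V, residueChar F w ∈ V)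
          (DK : Finset (HeightOneSpectrum (𝓞 K))) (_ : ∀ u, differentDivisor K (Sum.inr u) ≠ 0 → u ∈ DK)
          (vol : ℕ → ℝ) (volArch : ℝ),
          (∀ p ∈ V, -(1 / (((ℓ : ℝ) - 1) / 2)) * |vol p| ≤ ((ℓ : ℝ) + 1) / 4 *
            ((1 + 4 / (ℓ : ℝ)) *
                ((Module.finrank ℚ K : ℝ)⁻¹ *
                  ∑ u ∈ DK with residueChar K u = p, differentDivisor K (Sum.inr u) * logNorm K u)
              - 1 / 6 *
                ((Module.finrank ℚ F : ℝ)⁻¹ *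
                  ∑ w ∈ (TateDivisorDatum.ofNFPointOver P {2, ℓ} F).V with residueChar F w = p,
                    (TateDivisorDatum.ofNFPointOver P {2, ℓ} F).tateDivisor (Sum.inr w) * logNorm F w)
              + 4 / (ℓ : ℝ) * Real.log p
              + 20 / 3 * ((2 ^ 12 * 3 ^ 3 * 5 * eMod Lmod : ℕ) : ℝ) *
                (if p ≤ 2 ^ 12 * 3 ^ 3 * 5 * eMod Lmod * ℓ then Real.log p / p else 0))) ∧
          -(1 / (2 * (ℓ : ℝ)) * (TateDivisorDatum.ofNFPointOver P {2, ℓ} F).logq) ≤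
            -(1 / (((ℓ : ℝ) - 1) / 2)) * (∑ p ∈ V, |vol p| + |volArch|)) := fun h =>
  -- BY NAME: `h` is literally the hypothesis of p464392's `abc_of_genuineResidualSupport`
  have _hvacuous : ABC := abc_of_genuineResidualSupport h
  not_genuineResidualSupport_antecedent_degOne (h 1 one_pos)

end Summit.ABC.IUTFork.Joshi.ATS4

end
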